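/-
Copyright (c) 2026 the pub-hodgecm-mathlib formalisation cell (harness21).  Prover seat hodgecm-mathlib-K2E3-p21 (g7), HCML Track B «K2-LIT» ∕ h413
(`stmt-HodgeConjecture-24833`), line `K2_E3_EllipticInputs`, leaf (nsc-S-A′), brick (E4b) = discharge of `h3cell` of ★ E4a, part (E4b-1β) MIDDLE CELL (dealer D107), file 3b:
THE KERNEL OF THE MIDDLE-CELL MAP — a function vanishing on `P_{(2,1)}` all of whose middle-cell integrals vanish has the class of a function vanishing on `Z = {minor = 0}`.
-/
import Summits.HodgeConjecture.HodgeConjecture.Theorems.K2E3GL3BorelInducedJacquetQMiddleCellSupport   -- ★ file 3a (this seat, p860272): uniform support over integral `k`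
import Summits.HodgeConjecture.HodgeConjecture.Theorems.K2E3GL3UnipotentRadicalBoxSubgroup             -- ★ tool (this seat): box subgroups of `U_P`, `ℓ_k(K) = 𝔟_R`
import Summits.HodgeConjecture.HodgeConjecture.Theorems.K2E3CompactOpenAverageIntegral                 -- ★ (E4b-τ) K2E3-p14: (R1) relative push-forward, (R2) `e_K f` as a Haar average (+ τ1, `mk_restrictUnipotentGL_avgProj`)
import Literature.NumberTheory.Automorphic.IwasawaDecompositionGL                                     -- ★ `exists_borel_mul_glInt`
import Literature.NumberTheory.Automorphic.InducedWhittakerVanishing                                   -- ★ `permGL_inv`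
import HarnessLib

/-!
# K2_E3 road (h413), leaf (nsc-S-A′), brick (E4b-1β) file 3b — THE KERNEL OF THE MIDDLE-CELL MAP: `Ψ₁[f] ≡ 0 ⇒ [f] ∈ [X²]`

Cell `pub/hodgecm-mathlib` (D-0151), Track B, seat K2E3-p21 (g7).  `--supports stmt-HodgeConjecture-24833 --as helper`; THEOREMS ONLY; COUNT-NEUTRAL.

THE MATHEMATICS ([BernsteinZelevinsky1977, Thm. 5.2, middle orbit; §5 (5.14)]; [Casselman1995, §6.3 (Prop. 6.3.1, Thm. 6.3.5)]).  `P = P_{(2,1)}`, `B = B₃`, `s₂ = (1 2)`,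
`x₁₂(y) ∈ U_{α₂}`, `X¹ = {f ∈ Ind_B σ′ : f|_P = 0}`, `X² = {f : f|_Z = 0}`, `Z = {g : g₁₀g₂₁ − g₁₁g₂₀ = 0} = P ∪ B s₂ P`.  For `f ∈ X¹` with
`∫_F f(s₂ x₁₂(y) p) dy = 0` for all `p ∈ P` we find `f₂ ∈ X²` with the same class in the Jacquet module `r_P`:
* `f₂ := e_K f`, the average of `f` over a compact open BOX SUBGROUP `K = K_R ≤ U_P` (★ tool `exists_boxSubgroup`); `[e_K f] = [f]` (★ `mk_restrictUnipotentGL_avgProj`);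
* `R ≥ max(1, ε⁻¹)` where `ε` fixes `f` under the lower root elements (★ 1γ `exists_transvections_fix`), so that `y ↦ f(s₂ x₁₂(y) k)` is supported in `𝔟_R` for every
  integral `k ∈ P ∩ GL₃(𝒪)` (★ file 3a);
* for integral `k` and any `Y`: `(e_K f)(s₂ x₁₂(Y) k) = μ(K)⁻¹ ∫_K f(s₂ x₁₂(Y + ℓ_k(u)) k) du` (★ R2 + ★ file 1 `toFun_swap_coordOneTwo_mul_unipotent`, `ℓ_k(u) = (k u k⁻¹)₁₂`)
  `= c · ∫_{Y + ℓ_k(K)} φ_k` (★ R1, `ℓ_k(K) = 𝔟_R` by ★ tool) `= 0` (★ τ1: `φ_k` is supported in one coset of `𝔟_R` and has total integral `0`);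
* every `p ∈ P` is `b·k` with `b ∈ B`, `k` integral (★ Iwasawa), and `(e_K f)(s₂ b k) = σ′(s₂ t s₂⁻¹)·(e_K f)(s₂ x₁₂(n₁₂) k)` (★ file 1, `b = t n`); every `z ∈ Z ∖ P` is `x₁₂(λ) s₂ p`;
  on `P` itself `e_K f` vanishes with `f`.  Hence **`exists_mem_vanishingOn_minor_of_integral_eq_zero`**: `∃ f₂ ∈ X², mk f₂ = mk f`.

HONEST LABEL: HC_CM is proved only modulo the 7 printed citations (2 remaining named inputs: hLiu418 = stmt-HodgeConjecture-24832, h413 = stmt-HodgeConjecture-24833) until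
rung 0 closes; count-neutral helper.

## Mathlib ∕ tree search
★ R1 `setIntegral_comp_add_eq_smul_setIntegral_vadd`, ★ R2 `toFun_avgProj_map_subtype_eq_inv_smul_setIntegral`, ★ τ1 `setIntegral_leftAddCoset_eq_zero_of_support_subset`, ★ `mk_restrictUnipotentGL_avgProj` (K2E3-p14) ·
★ 3a `toFun_swap_coordOneTwo_eq_zero_of_mem_glInt` · ★ tool `exists_boxSubgroup`, `image_conj_one_two_boxSubgroup`, `conj_apply_one_two_mul_mul`, `conj_mem` · ★ file 1
`toFun_swap_coordOneTwo_mul_unipotent ∕ _blockDiagonalGL`, `continuous_middleCellFun` · ★ `exists_borel_mul_glInt`, `exists_transvections_fix`, `coord_one`, `coord_inv`, `permGL_inv`,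
`inducingChar_eq_one_of_mem_upperUnitriangular` · Mathlib `MeasureTheory.Measure.haarMeasure`.  Dedup: `lean search 'vanishingOn_minor_of_integral'` — none.

## References
* [BernsteinZelevinsky1977] I. N. Bernstein, A. V. Zelevinsky, *Induced representations of reductive p-adic groups I*, Ann. Sci. ÉNS 10 (1977), §5 (5.14), Thm. 5.2.
* [Casselman1995] W. Casselman, *Introduction to the theory of admissible representations of p-adic reductive groups* (draft 1995), §6.3 (Prop. 6.3.1, Thm. 6.3.5).
-/

set_option autoImplicit false
set_option linter.dupNamespace false

noncomputable section

open Set Function MeasureTheory Measure Representation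
open scoped MatrixGroups NNReal ENNReal Pointwise

namespace Summit.HodgeConjecture.HodgeConjecture.Cruxes.H413.K2E3GL3BorelInducedJacquetQMiddleCellKernel

open Literature.NumberTheory.Automorphic ValuativeRel
open Literature.NumberTheory.GaloisRepresentations Literature.NumberTheory.GaloisRepresentations.IsNonarchimedeanLocalField
open Summit.HodgeConjecture.HodgeConjecture.Cruxes.H413.K2E3GL3BorelUnipotentHaar
open Summit.HodgeConjecture.HodgeConjecture.Cruxes.H413.K2E3GL3BruhatCellSubgroups
open Summit.HodgeConjecture.HodgeConjecture.Cruxes.H413.K2E3GL3BruhatCellHaar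
open Summit.HodgeConjecture.HodgeConjecture.Cruxes.H413.K2E3GL3BruhatCellFunctionals
open Summit.HodgeConjecture.HodgeConjecture.Cruxes.H413.K2E3BorelCellJacquetLine
open Summit.HodgeConjecture.HodgeConjecture.Cruxes.H413.K2E3GL3BorelInducedJacquetQFiltration
open Summit.HodgeConjecture.HodgeConjecture.Cruxes.H413.K2E3GL3BorelInducedJacquetQMiddleCellIntegrand
open Summit.HodgeConjecture.HodgeConjecture.Cruxes.H413.K2E3GL3BorelInducedJacquetQMiddleCellSupport
open Summit.HodgeConjecture.HodgeConjecture.Cruxes.H413.K2E3GL3BorelInducedJacquetQOpenCellSupport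
open Summit.HodgeConjecture.HodgeConjecture.Cruxes.H413.K2E3GL3UnipotentRadicalBoxSubgroup
open Summit.HodgeConjecture.HodgeConjecture.Cruxes.H413.K2E3ZeroIntegralCosetAveraging
open Summit.HodgeConjecture.HodgeConjecture.Cruxes.H413.K2E3CompactOpenAverageIntegral

variable {F : Type} [Field F]

/-! ## §1 Algebra: the row-two entries of `s₂ x₁₂(y) z`, and `Z ∖ P ⊆ U_{α₂} s₂ P` -/

section Algebra

variable [TopologicalSpace F]
  (e : (F × F) × F ≃ₜ ↥(unipotentRadicalGL F (id : Fin 3 → Fin 3)))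
  (he : ∀ p : (F × F) × F, (((e p : ↥(unipotentRadicalGL F (id : Fin 3 → Fin 3))) : GL (Fin 3) F) : Matrix (Fin 3) (Fin 3) F) = !![1, p.1.1, p.2; 0, 1, p.1.2; 0, 0, 1])
include he

/-- Row `2` of `s₂ x₁₂(y) z` is `row₁(z) + y · row₂(z)`. [folklore] -/
theorem swap_coordOneTwo_mul_apply_two (y : F) (z : GL (Fin 3) F) (j : Fin 3) :
    (((permGL (Equiv.swap (1 : Fin 3) 2) : GL (Fin 3) F) * ((e ((0, y), 0) : ↥(unipotentRadicalGL F (id : Fin 3 → Fin 3))) : GL (Fin 3) F) * z : GL (Fin 3) F) : Matrix (Fin 3) (Fin 3) F) 2 j = ((z : Matrix (Fin 3) (Fin 3) F) 1 j) + y * ((z : Matrix (Fin 3) (Fin 3) F) 2 j) := by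
  simp only [Units.val_mul, coe_permGL, he]
  fin_cases j <;> simp [Matrix.mul_apply, Fin.sum_univ_three]

/-- **`Z ∖ P ⊆ x₁₂(F) · s₂ · P`**: a point of `Z = {g₁₀g₂₁ = g₁₁g₂₀}` outside `P_{(2,1)}` is `x₁₂(t) · s₂ · p` with `p ∈ P_{(2,1)}` (rows `1, 2` of `z` are proportional in their
first two entries). [cite: BernsteinZelevinsky1977, Thm. 5.2] -/
theorem exists_eq_coordOneTwo_mul_swap_mul [IsTopologicalRing F] {z : GL (Fin 3) F} (hz : z ∈ {g : GL (Fin 3) F | (g : Matrix (Fin 3) (Fin 3) F) 1 0 * (g : Matrix (Fin 3) (Fin 3) F) 2 1 - (g : Matrix (Fin 3) (Fin 3) F) 1 1 * (g : Matrix (Fin 3) (Fin 3) F) 2 0 = 0}) (hzP : z ∉ (standardParabolicGL F (![0, 0, 1] : Fin 3 → Fin 2))) :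
    ∃ (t : F) (p : GL (Fin 3) F), p ∈ (standardParabolicGL F (![0, 0, 1] : Fin 3 → Fin 2)) ∧ z = ((e ((0, t), 0) : ↥(unipotentRadicalGL F (id : Fin 3 → Fin 3))) : GL (Fin 3) F) * (permGL (Equiv.swap (1 : Fin 3) 2) : GL (Fin 3) F) * p := by
  rw [mem_setOf_eq] at hz
  rw [K2E3GL3MaximalParabolicRelabel.mem_standardParabolicGL_iff_entry, not_and_or] at hzP
  -- the ratio `t` with `row₁ = t · row₂` on the first two columns
  obtain ⟨t, h0, h1⟩ : ∃ t : F, ((z : Matrix (Fin 3) (Fin 3) F) 1 0) = t * ((z : Matrix (Fin 3) (Fin 3) F) 2 0) ∧ ((z : Matrix (Fin 3) (Fin 3) F) 1 1) = t * ((z : Matrix (Fin 3) (Fin 3) F) 2 1) := by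
    rcases hzP with h20 | h21
    · refine ⟨((z : Matrix (Fin 3) (Fin 3) F) 1 0) / ((z : Matrix (Fin 3) (Fin 3) F) 2 0), by field_simp, ?_⟩
      field_simp
      linear_combination -hz
    · refine ⟨((z : Matrix (Fin 3) (Fin 3) F) 1 1) / ((z : Matrix (Fin 3) (Fin 3) F) 2 1), ?_, by field_simp⟩
      field_simp
      linear_combination hz
  refine ⟨t, ((permGL (Equiv.swap (1 : Fin 3) 2) : GL (Fin 3) F))⁻¹ * (((e ((0, t), 0) : ↥(unipotentRadicalGL F (id : Fin 3 → Fin 3))) : GL (Fin 3) F))⁻¹ * z, ?_, by group⟩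
  -- `s₂⁻¹ x₁₂(t)⁻¹ z = s₂ x₁₂(−t) z` has row two `row₁(z) − t row₂(z) = (0, 0, *)`
  have hs : ((permGL (Equiv.swap (1 : Fin 3) 2) : GL (Fin 3) F))⁻¹ = (permGL (Equiv.swap (1 : Fin 3) 2) : GL (Fin 3) F) := by rw [permGL_inv, Equiv.swap_inv]
  have hE : (((e ((0, t), 0) : ↥(unipotentRadicalGL F (id : Fin 3 → Fin 3))) : GL (Fin 3) F))⁻¹ = ((e ((0, -t), 0) : ↥(unipotentRadicalGL F (id : Fin 3 → Fin 3))) : GL (Fin 3) F) := by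
    rw [← Subgroup.coe_inv, coord_inv e he]; norm_num
  rw [hs, hE, K2E3GL3MaximalParabolicRelabel.mem_standardParabolicGL_iff_entry, swap_coordOneTwo_mul_apply_two e he, swap_coordOneTwo_mul_apply_two e he, h0, h1]
  constructor <;> ring

end Algebra

/-! ## §2 The kernel -/

section Kernel

variable [ValuativeRel F] [TopologicalSpace F] [IsNonarchimedeanLocalField F] [MeasurableSpace F] [BorelSpace F]
  (μ : Measure F) [μ.IsAddHaarMeasure]
  (χ : (Π a : Fin 3, GL {i : Fin 3 // (id : Fin 3 → Fin 3) i = a} F) →* ℂˣ)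
  (e : (F × F) × F ≃ₜ ↥(unipotentRadicalGL F (id : Fin 3 → Fin 3)))
  (he : ∀ p : (F × F) × F, (((e p : ↥(unipotentRadicalGL F (id : Fin 3 → Fin 3))) : GL (Fin 3) F) : Matrix (Fin 3) (Fin 3) F) = !![1, p.1.1, p.2; 0, 1, p.1.2; 0, 0, 1])
include he

set_option maxHeartbeats 1600000 in  -- long induced-space types (elaboration ∕ `whnf`, no search)
/-- **THE KERNEL OF THE MIDDLE-CELL MAP.**  Let `f ∈ Ind_{B₃}^{GL₃}(σ′)` vanish on `P = P_{(2,1)}` and suppose all its middle-cell integrals vanish: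
`∫_F f(s₂ · x₁₂(y) · p) dμ(y) = 0` for every `p ∈ P`.  Then there is `f₂` vanishing on `Z = {g : g₁₀g₂₁ − g₁₁g₂₀ = 0}` (`= P ∪ B s₂ P`) with the same class in the Jacquet
module `r_P(Ind σ′)`: `mk f₂ = mk f` — namely `f₂ = e_K f` for a large box subgroup `K ≤ U_P`. [cite: BernsteinZelevinsky1977, Thm. 5.2] [cite: Casselman1995, §6.3, Thm. 6.3.5] -/
theorem exists_mem_vanishingOn_minor_of_integral_eq_zero (f : SmoothInd (standardParabolicGL F (id : Fin 3 → Fin 3)) (Representation.twist (((Representation.trivial ℂ (Π a : Fin 3, GL {i : Fin 3 // (id : Fin 3 → Fin 3) i = a} F) ℂ).twist χ).comp (leviProjection F (id : Fin 3 → Fin 3))) (rootDeltaChar (standardParabolicGL F (id : Fin 3 → Fin 3))))) (hf : f ∈ (vanishingOn (standardParabolicGL F (id : Fin 3 → Fin 3)) (Representation.twist (((Representation.trivial ℂ (Π a : Fin 3, GL {i : Fin 3 // (id : Fin 3 → Fin 3) i = a} F) ℂ).twist χ).comp (leviProjection F (id : Fin 3 → Fin 3))) (rootDeltaChar (standardParabolicGL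 F (id : Fin 3 → Fin 3)))) ((standardParabolicGL F (![0, 0, 1] : Fin 3 → Fin 2)) : Set (GL (Fin 3) F))))
    (hzero : ∀ p ∈ (standardParabolicGL F (![0, 0, 1] : Fin 3 → Fin 2)), ∫ y, f.toFun ((permGL (Equiv.swap (1 : Fin 3) 2) : GL (Fin 3) F) * ((e ((0, y), 0) : ↥(unipotentRadicalGL F (id : Fin 3 → Fin 3))) : GL (Fin 3) F) * p) ∂μ = 0) :
    ∃ f₂ ∈ vanishingOn (standardParabolicGL F (id : Fin 3 → Fin 3)) (Representation.twist (((Representation.trivial ℂ (Π a : Fin 3, GL {i : Fin 3 // (id : Fin 3 → Fin 3) i = a} F) ℂ).twist χ).comp (leviProjection F (id : Fin 3 → Fin 3))) (rootDeltaChar (standardParabolicGL F (id : Fin 3 → Fin 3)))) {g : GL (Fin 3) F | (g : Matrix (Fin 3) (Fin 3) F) 1 0 * (g : Matrix (Fin 3) (Fin 3) F) 2 1 - (g : Matrix (Fin 3) (Fin 3) F) 1 1 * (g : Matrix (Fin 3) (Fin 3) F) 2 0 = 0},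
      Representation.Coinvariants.mk (restrictUnipotentGL F (![0, 0, 1] : Fin 3 → Fin 2) (smoothIndRep (standardParabolicGL F (id : Fin 3 → Fin 3)) (Representation.twist (((Representation.trivial ℂ (Π a : Fin 3, GL {i : Fin 3 // (id : Fin 3 → Fin 3) i = a} F) ℂ).twist χ).comp (leviProjection F (id : Fin 3 → Fin 3))) (rootDeltaChar (standardParabolicGL F (id : Fin 3 → Fin 3)))))) f₂ = Representation.Coinvariants.mk (restrictUnipotentGL F (![0, 0, 1] : Fin 3 → Fin 2) (smoothIndRep (standardParabolicGL F (id : Fin 3 → Fin 3)) (Representation.twist (((Representation.trivial ℂ (Π a : Fin 3, GL {i : Fin 3 // (id : Fin 3 → Fin 3) i = a} F) ℂ).twist χ).comp (leviProjection F (id : Fin 3 → Fin 3))) (rootDeltaChar (standardParabolicGL F (id : Fin 3 → Fin 3)))))) f := by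
  haveI : IsTopologicalRing F := inferInstance
  haveI : T2Space F := (isLocalField F).toT2Space
  haveI : SecondCountableTopology F := secondCountableTopology_localField F
  -- Haar on `U = U_P` (Bool labelling), Borel structure
  letI : MeasurableSpace ↥(unipotentRadicalGL F (![false, false, true] : Fin 3 → Bool)) := borel _
  haveI : BorelSpace ↥(unipotentRadicalGL F (![false, false, true] : Fin 3 → Bool)) := ⟨rfl⟩
  -- (1) the fixing radius `ε` of `f` and the box radius `R = max 1 ε⁻¹`
  obtain ⟨ε, hα, hβ⟩ := exists_transvections_fix (Representation.twist (((Representation.trivial ℂ (Π a : Fin 3, GL {i : Fin 3 // (id : Fin 3 → Fin 3) i = a} F) ℂ).twist χ).comp (leviProjection F (id : Fin 3 → Fin 3))) (rootDeltaChar (standardParabolicGL F (id : Fin 3 → Fin 3)))) f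
  have hε0 : (ε : ValueGroupWithZero F) ≠ 0 := ε.ne_zero
  set R : ValueGroupWithZero F := max 1 (ε : ValueGroupWithZero F)⁻¹ with hR
  have hR0 : R ≠ 0 := ne_of_gt (lt_of_lt_of_le zero_lt_one (le_max_left _ _))
  obtain ⟨L, hL⟩ := exists_ballAddSubgroup (F := F) R
  -- (2) the box subgroup `K ≤ U` and its Haar measure
  obtain ⟨K, hKc, hKo, hK⟩ := exists_boxSubgroup e he hR0
  let K₀ : TopologicalSpace.PositiveCompacts ↥(unipotentRadicalGL F (![false, false, true] : Fin 3 → Bool)) := ⟨⟨(K : Set ↥(unipotentRadicalGL F (![false, false, true] : Fin 3 → Bool))), hKc⟩, by rw [hKo.interior_eq]; exact ⟨1, K.one_mem⟩⟩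
  let μU : Measure ↥(unipotentRadicalGL F (![false, false, true] : Fin 3 → Bool)) := Measure.haarMeasure K₀
  -- (3) the averaged function
  let S : Subgroup (GL (Fin 3) F) := K.map (unipotentRadicalGL F (![false, false, true] : Fin 3 → Bool)).subtype
  have hSc : IsCompact (S : Set (GL (Fin 3) F)) := by rw [Subgroup.coe_map]; exact hKc.image continuous_subtype_val
  have hSU : S ≤ unipotentRadicalGL F (![0, 0, 1] : Fin 3 → Fin 2) := by
    rw [K2E3GL3MaximalParabolicRelabel.unipotentRadicalGL_eq_bool]; exact Subgroup.map_subtype_le K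
  set f₂ : SmoothInd (standardParabolicGL F (id : Fin 3 → Fin 3)) (Representation.twist (((Representation.trivial ℂ (Π a : Fin 3, GL {i : Fin 3 // (id : Fin 3 → Fin 3) i = a} F) ℂ).twist χ).comp (leviProjection F (id : Fin 3 → Fin 3))) (rootDeltaChar (standardParabolicGL F (id : Fin 3 → Fin 3)))) := (smoothIndRep (standardParabolicGL F (id : Fin 3 → Fin 3)) (Representation.twist (((Representation.trivial ℂ (Π a : Fin 3, GL {i : Fin 3 // (id : Fin 3 → Fin 3) i = a} F) ℂ).twist χ).comp (leviProjection F (id : Fin 3 → Fin 3))) (rootDeltaChar (standardParabolicGL F (id : Fin 3 → Fin 3))))).avgProj S f with hf₂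
  refine ⟨f₂, ?_, mk_restrictUnipotentGL_avgProj (![0, 0, 1] : Fin 3 → Fin 2) (smoothIndRep (standardParabolicGL F (id : Fin 3 → Fin 3)) (Representation.twist (((Representation.trivial ℂ (Π a : Fin 3, GL {i : Fin 3 // (id : Fin 3 → Fin 3) i = a} F) ℂ).twist χ).comp (leviProjection F (id : Fin 3 → Fin 3))) (rootDeltaChar (standardParabolicGL F (id : Fin 3 → Fin 3))))) hSc hSU (isSmooth_smoothInd _ _ f)⟩
  -- (4) the value formula of `f₂ = e_K f` (★ R2)
  have hval : ∀ x : GL (Fin 3) F, f₂.toFun x = (μU.real (K : Set ↥(unipotentRadicalGL F (![false, false, true] : Fin 3 → Bool))))⁻¹ • ∫ u in (K : Set ↥(unipotentRadicalGL F (![false, false, true] : Fin 3 → Bool))), f.toFun (x * (u : GL (Fin 3) F)) ∂μU := fun x =>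
    toFun_avgProj_map_subtype_eq_inv_smul_setIntegral (standardParabolicGL F (id : Fin 3 → Fin 3)) (Representation.twist (((Representation.trivial ℂ (Π a : Fin 3, GL {i : Fin 3 // (id : Fin 3 → Fin 3) i = a} F) ℂ).twist χ).comp (leviProjection F (id : Fin 3 → Fin 3))) (rootDeltaChar (standardParabolicGL F (id : Fin 3 → Fin 3)))) (unipotentRadicalGL F (![false, false, true] : Fin 3 → Bool)) μU K hKc hKo f x
  -- (5) on `P` itself `f₂` vanishes with `f`
  have hP : ∀ p ∈ (standardParabolicGL F (![0, 0, 1] : Fin 3 → Fin 2)), f₂.toFun p = 0 := fun p hp => by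
    rw [hval]
    have h0 : ∀ u : ↥(unipotentRadicalGL F (![false, false, true] : Fin 3 → Bool)), f.toFun (p * (u : GL (Fin 3) F)) = 0 := fun u =>
      hf _ (Subgroup.mul_mem _ hp (unipotentRadicalGL_le F (![0, 0, 1] : Fin 3 → Fin 2) (by rw [K2E3GL3MaximalParabolicRelabel.unipotentRadicalGL_eq_bool]; exact u.2)))
    simp only [h0, integral_zero, smul_zero]
  -- (6) the heart: `f₂(s₂ x₁₂(Y) k) = 0` for integral `k ∈ P`
  have hint_k : ∀ {k : GL (Fin 3) F}, k ∈ (standardParabolicGL F (![0, 0, 1] : Fin 3 → Fin 2)) → k ∈ glInt 3 F → ∀ Y : F, f₂.toFun ((permGL (Equiv.swap (1 : Fin 3) 2) : GL (Fin 3) F) * ((e ((0, Y), 0) : ↥(unipotentRadicalGL F (id : Fin 3 → Fin 3))) : GL (Fin 3) F) * k) = 0 := by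
    intro k hkP hkO Y
    rw [hval]
    -- the integrand is `φ_k (Y + ℓ_k u)`
    have hu3 : ∀ u : ↥(unipotentRadicalGL F (![false, false, true] : Fin 3 → Bool)), k * (u : GL (Fin 3) F) * k⁻¹ ∈ upperUnitriangular (Fin 3) F := fun u =>
      ((mem_unipotentRadicalGL_twoOne_iff _).1 (conj_mem hkP u)).1
    have hpt : ∀ u : ↥(unipotentRadicalGL F (![false, false, true] : Fin 3 → Bool)), f.toFun ((permGL (Equiv.swap (1 : Fin 3) 2) : GL (Fin 3) F) * ((e ((0, Y), 0) : ↥(unipotentRadicalGL F (id : Fin 3 → Fin 3))) : GL (Fin 3) F) * k * (u : GL (Fin 3) F)) =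
        f.toFun ((permGL (Equiv.swap (1 : Fin 3) 2) : GL (Fin 3) F) * ((e ((0, Y + ((k * (u : GL (Fin 3) F) * k⁻¹ : GL (Fin 3) F) : Matrix (Fin 3) (Fin 3) F) 1 2), 0) : ↥(unipotentRadicalGL F (id : Fin 3 → Fin 3))) : GL (Fin 3) F) * k) := fun u => by
      rw [← toFun_swap_coordOneTwo_mul_unipotent χ e he f Y (hu3 u) k]
      congr 1; group
    simp only [hpt]
    -- ★ R1: push the `K`-integral forward to the coset `Y + ℓ_k(K) = Y + 𝔟_R`
    have hℓc := continuous_conj_apply_one_two (F := F) k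
    have hℓadd := conj_apply_one_two_mul_mul (F := F) hkP
    have himage : (fun u : ↥(unipotentRadicalGL F (![false, false, true] : Fin 3 → Bool)) => ((k * (u : GL (Fin 3) F) * k⁻¹ : GL (Fin 3) F) : Matrix (Fin 3) (Fin 3) F) 1 2) '' (K : Set ↥(unipotentRadicalGL F (![false, false, true] : Fin 3 → Bool))) = (L : Set F) := by
      rw [hL]; exact image_conj_one_two_boxSubgroup e he hK hkP hkO
    have hKL : IsOpen ((fun u : ↥(unipotentRadicalGL F (![false, false, true] : Fin 3 → Bool)) => ((k * (u : GL (Fin 3) F) * k⁻¹ : GL (Fin 3) F) : Matrix (Fin 3) (Fin 3) F) 1 2) '' (K : Set ↥(unipotentRadicalGL F (![false, false, true] : Fin 3 → Bool)))) := by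
      rw [himage, hL]; exact DeltaCharBorel.isOpen_setOf_valuation_le hR0
    have hsm : StronglyMeasurable fun y : F => f.toFun ((permGL (Equiv.swap (1 : Fin 3) 2) : GL (Fin 3) F) * ((e ((0, y), 0) : ↥(unipotentRadicalGL F (id : Fin 3 → Fin 3))) : GL (Fin 3) F) * k) :=
      (continuous_middleCellFun e (Representation.twist (((Representation.trivial ℂ (Π a : Fin 3, GL {i : Fin 3 // (id : Fin 3 → Fin 3) i = a} F) ℂ).twist χ).comp (leviProjection F (id : Fin 3 → Fin 3))) (rootDeltaChar (standardParabolicGL F (id : Fin 3 → Fin 3)))) f k).stronglyMeasurable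
    rw [setIntegral_comp_add_eq_smul_setIntegral_vadd μU μ _ hℓc hℓadd K hKc hKL hsm Y, himage]
    -- ★ τ1: `φ_k` is supported in `𝔟_R = 0 + L` and has total integral `0`
    have hsupp : Function.support (fun y : F => f.toFun ((permGL (Equiv.swap (1 : Fin 3) 2) : GL (Fin 3) F) * ((e ((0, y), 0) : ↥(unipotentRadicalGL F (id : Fin 3 → Fin 3))) : GL (Fin 3) F) * k)) ⊆ (0 : F) +ᵥ (L : Set F) := by
      intro y hy
      rw [zero_vadd, hL, mem_setOf_eq]
      by_contra hlt
      push Not at hlt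
      exact hy (toFun_swap_coordOneTwo_eq_zero_of_mem_glInt (Representation.twist (((Representation.trivial ℂ (Π a : Fin 3, GL {i : Fin 3 // (id : Fin 3 → Fin 3) i = a} F) ℂ).twist χ).comp (leviProjection F (id : Fin 3 → Fin 3))) (rootDeltaChar (standardParabolicGL F (id : Fin 3 → Fin 3)))) e he hf hα hβ hkP hkO
        (lt_of_le_of_lt (le_max_left _ _) hlt) (lt_of_le_of_lt (le_max_right _ _) hlt))
    rw [setIntegral_leftAddCoset_eq_zero_of_support_subset μ L hsupp (hzero k hkP) Y, smul_zero, smul_zero, smul_zero]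
  -- (7) all of `s₂ P` by Iwasawa and the `B`-covariance of ★ file 1
  have hBP : (standardParabolicGL F (id : Fin 3 → Fin 3)) ≤ (standardParabolicGL F (![0, 0, 1] : Fin 3 → Fin 2)) := standardParabolicGL_id_le_of_monotone K2E3GL3MaximalParabolicRelabel.monotone_twoOne
  have hsP : ∀ p ∈ (standardParabolicGL F (![0, 0, 1] : Fin 3 → Fin 2)), f₂.toFun ((permGL (Equiv.swap (1 : Fin 3) 2) : GL (Fin 3) F) * p) = 0 := by
    intro p hp
    obtain ⟨b, hb, k, hkO, hpk⟩ := exists_borel_mul_glInt p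
    have hkP : k ∈ (standardParabolicGL F (![0, 0, 1] : Fin 3 → Fin 2)) := by
      have hk : k = b⁻¹ * p := by rw [hpk, inv_mul_cancel_left]
      rw [hk]; exact Subgroup.mul_mem _ (Subgroup.inv_mem _ (hBP hb)) hp
    -- `b = t · n`, `t = diag(levi b)`, `n ∈ U₃`
    set m := leviProjection F (id : Fin 3 → Fin 3) ⟨b, hb⟩ with hm_def
    have hn : (blockDiagonalGL F (id : Fin 3 → Fin 3) m)⁻¹ * b ∈ upperUnitriangular (Fin 3) F := by
      refine ⟨(leviEmbeddingP F (id : Fin 3 → Fin 3) m)⁻¹ * ⟨b, hb⟩, (MonoidHom.mem_ker).2 ?_, ?_⟩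
      · rw [map_mul, map_inv, hm_def, leviProjection_leviEmbeddingP_apply, inv_mul_cancel]
      · simp only [Subgroup.coe_subtype, Subgroup.coe_mul, Subgroup.coe_inv, coe_leviEmbeddingP]
    have hE0 : ((e ((0, 0), 0) : ↥(unipotentRadicalGL F (id : Fin 3 → Fin 3))) : GL (Fin 3) F) = 1 := by rw [coord_one e he, OneMemClass.coe_one]
    have hrw : (permGL (Equiv.swap (1 : Fin 3) 2) : GL (Fin 3) F) * p = (permGL (Equiv.swap (1 : Fin 3) 2) : GL (Fin 3) F) * ((e ((0, 0), 0) : ↥(unipotentRadicalGL F (id : Fin 3 → Fin 3))) : GL (Fin 3) F) * blockDiagonalGL F (id : Fin 3 → Fin 3) m * (((blockDiagonalGL F (id : Fin 3 → Fin 3) m)⁻¹ * b) * k) := by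
      rw [hE0, hpk]; group
    have h1 := toFun_swap_coordOneTwo_mul_blockDiagonalGL χ e he f₂ 0 m (((blockDiagonalGL F (id : Fin 3 → Fin 3) m)⁻¹ * b) * k)
    rw [zero_mul, zero_div] at h1
    have h2 : f₂.toFun ((permGL (Equiv.swap (1 : Fin 3) 2) : GL (Fin 3) F) * ((e ((0, 0), 0) : ↥(unipotentRadicalGL F (id : Fin 3 → Fin 3))) : GL (Fin 3) F) * (((blockDiagonalGL F (id : Fin 3 → Fin 3) m)⁻¹ * b) * k)) = 0 := by
      rw [show (permGL (Equiv.swap (1 : Fin 3) 2) : GL (Fin 3) F) * ((e ((0, 0), 0) : ↥(unipotentRadicalGL F (id : Fin 3 → Fin 3))) : GL (Fin 3) F) * (((blockDiagonalGL F (id : Fin 3 → Fin 3) m)⁻¹ * b) * k) =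
          (permGL (Equiv.swap (1 : Fin 3) 2) : GL (Fin 3) F) * ((e ((0, 0), 0) : ↥(unipotentRadicalGL F (id : Fin 3 → Fin 3))) : GL (Fin 3) F) * ((blockDiagonalGL F (id : Fin 3 → Fin 3) m)⁻¹ * b) * k from (mul_assoc _ _ _).symm,
        toFun_swap_coordOneTwo_mul_unipotent χ e he f₂ 0 hn k]
      exact hint_k hkP hkO _
    rw [hrw, h1, h2, mul_zero]
  -- (8) `Z = P ∪ x₁₂(F) s₂ P`
  intro z hz
  by_cases hzP : z ∈ (standardParabolicGL F (![0, 0, 1] : Fin 3 → Fin 2))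
  · exact hP z hzP
  · obtain ⟨t, p, hp, rfl⟩ := exists_eq_coordOneTwo_mul_swap_mul e he hz hzP
    rw [mul_assoc, show ((e ((0, t), 0) : ↥(unipotentRadicalGL F (id : Fin 3 → Fin 3))) : GL (Fin 3) F) = ((⟨((e ((0, t), 0) : ↥(unipotentRadicalGL F (id : Fin 3 → Fin 3))) : GL (Fin 3) F), unipotentRadicalGL_le F (id : Fin 3 → Fin 3) (e ((0, t), 0)).2⟩ : ↥(standardParabolicGL F (id : Fin 3 → Fin 3))) : GL (Fin 3) F) from rfl,
      SmoothInd.toFun_subgroup_mul, hsP p hp, map_zero]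

end Kernel

end Summit.HodgeConjecture.HodgeConjecture.Cruxes.H413.K2E3GL3BorelInducedJacquetQMiddleCellKernel

end
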